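import Summits.FinalStateConjecture.FinalStateConjecture.Theorems.NeckGapDecay.Negative.ExactSchwarzschildLateModel

/-!
# `NeckGapDecay` (crux stmt-FinalStateConjecture-16768, route StarvedNecks) — negative side, model facts (2/2):
# the exact Schwarzschild exterior is an honest input AND carries the gap certificate (G0)–(G5)

Refuter seat `refuter-cdisprove-stmt-FinalStateConjecture-16768-0` (crux disprover, 2026-08-17).
Small-model facts for the crux `Theses.StarvedNecks.NeckGapDecay` (no Theses statement is asserted):

* `GapCertificate 𝓢 O k d R₀ i` — the CONCLUSION of the crux for hole `i`, verbatim (wall factor `3`,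
  clauses (G0)–(G5)), over an arbitrary spacetime / region / decomposition (the crux binds it to a
  maximal vacuum Cauchy development of admissible data and `O = exteriorOf …`).
* `SchwGap.honestCore_decompK`, `SchwGap.honestFar_decompK`, `SchwGap.distinctVelocities_decompK`:
  the three antecedent bundles `Hc`, `Hf`, DV of the crux (verbatim `let`-lambdas) hold on the model
  `SchwGap.decompK P k` of part 1 (`ExactSchwarzschildLateModel`).
* `SchwGap.gapCertificate_decompK` : `∀ i, GapCertificate (ST P) (O P) k (decompK P k) P.R₀ i` with the
  INTENDED witness `R₁ = R₀`, `τ₁ = τ₀`, `W = 3ρ + 2`, `Ψg = Ψᵢ`: (G1) the late sub-wall tube is open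
  in the chart domain and the identity is an open embedding into the hole region ⊆ `d.charted`;
  (G3) the deviation vanishes identically; (G4) `∂₀` is future timelike on `r ≥ R₀ > 2M`; (G5) the
  closure of a closed sub-wall tube portion adds only horizon points, which are not in `O`.
* `exists_N_one_honest_gapCertified` : packaged non-vacuity — SOME `C⁴` decomposition with a hole
  satisfies `Hc ∧ Hf ∧ DV` together with the conclusion of the crux for every hole.

What this shows for the crux (refuter protocol step 6(i)): the antecedent shape `Hc ∧ Hf ∧ DV` has a
genuine `N = 1` inhabitant (not `PUnit`, not `N = 0`), and the six conclusion clauses are JOINTLY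
satisfiable there by the intended witness — so (G0)–(G5) carry no typing slip that would make the crux
false for a silly reason (e.g. (G5) at the horizon, (G1)'s open-embedding-on-a-sub-tube typing, the
flat-time argument `x.1 0` of the wall).  What it does NOT show: anything about maximal vacuum Cauchy
developments of admissible data (the model region is the exterior of a Kerr–Schild patch chosen by
hand, `O = {r > 2M}`; for `r₀ = 2M` it has the shape `J⁺(univ) ∩ I⁻(charted)`,
`SchwModel.O_eq_core`), nor the physics of the crux (the neck of a DYNAMICAL hole).

References: Dafermos–Rodnianski arXiv:0811.0354 §5.1; Kerr–Schild 1965 §3; O'Neill 1983 Ch. 14;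
DHRT arXiv:2104.08222 §1.
-/

noncomputable section

open TopologicalSpace Manifold Filter Topology Set Function
open scoped ContDiff Topology ENNReal Manifold

-- instance search through nested operator types `E4 →L E4 →L E4 →L ℝ` (as in the tree files)
set_option maxSynthPendingDepth 3

namespace Summit.FinalStateConjecture.FinalStateConjecture.Theorems.NeckGapDecay.Negative

open Literature.Geometry.Lorentzian LorentzianMetric
open Summit.FinalStateConjecture.FinalStateConjecture.Theorems.SeamedChartsExhaust.Negative
open Summit.FinalStateConjecture.FinalStateConjecture.Theorems.SeamedChartsExhaust.Negative.SchwModel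

set_option linter.dupNamespace false

/-- **The gap certificate of hole `i`** — the conclusion of `Theses.StarvedNecks.NeckGapDecay`,
verbatim (wall factor `3`): radii/time `R₁ ≥ R₀`, `τ₁ ≥ τ₀`, a continuous wall `W` with
`3ρᵢ(s) + 2 ≤ W(s)` for flat times `s ≥ τ₁` (G0); a chart `Ψg` of the hole background domain which
is a smooth open embedding of the late sub-wall tube `U = {τ₁ < tᵢ, rᵢ < W(x⁰) + 1}` into
`d.charted` (G1), equal to `d.chart i` inside `R₁ + 1` (G2), with `C²` deviation from boosted Kerrᵢ
tending to `0` on the hole slabs out to the wall (G3), future-directed `Λᵢe₀`-lines on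
`R₁ ≤ rᵢ ≤ W(x⁰)` from `τ₁` (G4), and relatively closed (in `O`) closed sub-wall tube portions (G5).
[topic: Summits/FinalStateConjecture/FinalStateConjecture — route StarvedNecks, crux NeckGapDecay] -/
def GapCertificate (𝓢 : Spacetime.{0} 4) (O : Set 𝓢.carrier) (k : ℕ)
    (d : FinalStateDecomposition 𝓢 O k) (R₀ : ℝ) (i : Fin d.N) : Prop :=
  ∃ (R₁ τ₁ : ℝ) (W : ℝ → ℝ) (Ψg : (d.background i).domain → 𝓢.carrier), let B:=d.background i; let t:=B.time; let r:=B.radius; R₀ ≤ R₁ ∧ d.τ₀ ≤ τ₁ ∧ Continuous W ∧ (∀ s, τ₁ ≤ s → 3 * d.excision i s + 2 ≤ W s) ∧ (let U : Set B.domain := {x | τ₁ < t x.1 ∧ r x.1 < W (x.1 0) + 1}; ContMDiffOn 𝓘(ℝ, E4) (𝓡 4) ∞ Ψg U ∧ Topology.IsOpenEmbedding (U.restrict Ψg) ∧ Ψg '' U ⊆ d.charted) ∧ (∀ x : B.domain, r x.1 ≤ R₁ + 1 → Ψg x = d.chart i x) ∧ Tendsto (fun τ ↦ supCkENorm (Subtype.val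 '' {x : B.domain | t x.1 = τ ∧ r x.1 ≤ W (x.1 0)}) 2 (𝓢.deviationExtend B Ψg)) atTop (𝓝 0) ∧ (∀ x : B.domain, τ₁ ≤ t x.1 → R₁ ≤ r x.1 → r x.1 ≤ W (x.1 0) → 𝓢.timeOrientation.IsFutureDirected (mfderiv 𝓘(ℝ, E4) (𝓡 4) Ψg x (((d.motion i).1 : E4 ≃L[ℝ] E4) (E4.basisVector 0)))) ∧ (∀ (τ' : ℝ) (ϱ : ℝ → ℝ), Continuous ϱ → τ₁ < τ' → (∀ x : B.domain, τ' ≤ t x.1 → r x.1 ≤ ϱ (t x.1) → r x.1 ≤ W (x.1 0)) → closure (Ψg '' {x | τ' ≤ t x.1 ∧ r x.1 ≤ ϱ (t x.1)}) ∩ O ⊆ Ψg '' {x | τ' ≤ t x.1 ∧ r x.1 ≤ ϱ (t x.1)})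

namespace SchwGap

variable (P : Params) (k : ℕ)

/-! ### The gap certificate on the model -/

/-- **The intended witness certifies the gap on exact Schwarzschild**: for every hole of the model,
`GapCertificate` holds with `R₁ = R₀`, `τ₁ = τ₀ = 1`, `W = 3ρ + 2`, `Ψg =` the identity hole chart. -/
theorem gapCertificate_decompK (i : Fin (decompK P k).N) :
    GapCertificate (ST P) (O P) k (decompK P k) P.R₀ i := by
  have hW : Continuous (fun s : ℝ ↦ 3 * ρ P s + 2) :=
    (continuous_const.mul (continuous_ρ P)).add continuous_const
  refine ⟨P.R₀, 1, fun s ↦ 3 * ρ P s + 2, Ψ P, le_rfl, le_rfl, hW, fun s _ ↦ le_rfl,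
    ⟨?_, ?_, ?_⟩, fun x _ ↦ rfl, ?_, ?_, ?_⟩
  · -- (G1a) smooth
    exact (contMDiff_inclusion (n := ∞) (hbext P)).contMDiffOn
  · -- (G1b) open embedding of the (open) late sub-wall tube
    set Uset : Set (boostedKerrBackground 1 0 P.M 0).domain :=
      {x | 1 < (boostedKerrBackground 1 0 P.M 0).time x.1 ∧
        (boostedKerrBackground 1 0 P.M 0).radius x.1 < (3 * ρ P (x.1 0) + 2) + 1} with hUset
    have hopen : IsOpen Uset := by
      have h1 : Continuous fun x : (boostedKerrBackground 1 0 P.M 0).domain ↦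
          (boostedKerrBackground 1 0 P.M 0).time x.1 :=
        ((PiLp.continuous_apply 2 _ 0).comp (continuous_poincareInv 1 0)).comp
          continuous_subtype_val
      have h2 : Continuous fun x : (boostedKerrBackground 1 0 P.M 0).domain ↦
          (boostedKerrBackground 1 0 P.M 0).radius x.1 :=
        ((Kerr.continuous_radius 0).comp (continuous_poincareInv 1 0)).comp continuous_subtype_val
      have h3 : Continuous fun x : (boostedKerrBackground 1 0 P.M 0).domain ↦
          (3 * ρ P (x.1 0) + 2) + 1 :=
        (hW.comp ((PiLp.continuous_apply 2 _ 0).comp continuous_subtype_val)).add continuous_const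
      exact (isOpen_lt continuous_const h1).inter (isOpen_lt h2 h3)
    have hg : IsOpenEmbedding (fun x : Uset ↦ (x.1.1 : E4)) :=
      (boostedKerrExterior 1 0 P.M 0).2.isOpenEmbedding_subtypeVal.comp
        hopen.isOpenEmbedding_subtypeVal
    have hcar : IsOpenEmbedding (Subtype.val : (ST P).carrier → E4) :=
      (Kerr.region 0 P.r₀).2.isOpenEmbedding_subtypeVal
    exact IsOpenEmbedding.of_comp _ hcar hg
  · -- (G1c) image in the charted late region (the hole region of the model)
    rintro _ ⟨x, ⟨hx1, -⟩, rfl⟩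
    refine FinalStateDecomposition.region_subset_charted _ i ⟨x, ?_, rfl⟩
    exact hx1
  · -- (G3) the deviation of the identity chart vanishes identically
    show Tendsto (fun τ ↦ supCkENorm _ 2
      ((ST P).deviationExtend (boostedKerrBackground 1 0 P.M 0) (Ψ P))) atTop (𝓝 0)
    simp_rw [deviationExtend_Ψ, supCkENorm_zero]
    exact tendsto_const_nhds
  · -- (G4) `Λ e₀ = e₀` is future timelike on `r ≥ R₀ > 2M`
    intro x _ hR₀ _
    simp only [decompK_background, bg_radius] at hR₀
    have hrad : 2 * P.M < Kerr.radius 0 (Ψ P x).1 := by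
      rw [Ψ_val]; linarith [P.two_M_lt_R₀]
    show (ST P).timeOrientation.IsFutureDirected (x := Ψ P x)
      (mfderiv 𝓘(ℝ, E4) (𝓡 4) (Ψ P) x ((((1 : lorentzGroup) : E4 ≃L[ℝ] E4) (E4.basisVector 0))))
    rw [motion_e0]
    exact (congrArg (fun w : E4 ↦ (ST P).timeOrientation.IsFutureDirected (x := Ψ P x) w)
      (OpensChart.mfderiv_inclusion_apply (hbext P) x (E4.basisVector 0))).mpr
        (Schw.isFutureDirected_e0 (hM := P.hM.le) (Ψ P x) hrad)
  · -- (G5) relative closedness in `O`: the closure adds only horizon points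
    intro τ' ϱ hϱ _ _ z hz
    obtain ⟨hzc, hzO⟩ := hz
    set C : Set E4 := {w | τ' ≤ w 0 ∧ Kerr.radius 0 w ≤ ϱ (w 0)} with hC
    have hCc : IsClosed C :=
      (isClosed_le continuous_const (PiLp.continuous_apply 2 _ 0)).inter
        (isClosed_le (Kerr.continuous_radius 0) (hϱ.comp (PiLp.continuous_apply 2 _ 0)))
    have hsub : Ψ P '' {x | τ' ≤ (boostedKerrBackground 1 0 P.M 0).time x.1 ∧
        (boostedKerrBackground 1 0 P.M 0).radius x.1 ≤
          ϱ ((boostedKerrBackground 1 0 P.M 0).time x.1)} ⊆ Subtype.val ⁻¹' C := by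
      rintro _ ⟨x, ⟨h1, h2⟩, rfl⟩
      simp only [bg_time, bg_radius] at h1 h2
      exact ⟨h1, h2⟩
    have hz1 : z.1 ∈ C := closure_minimal hsub (hCc.preimage continuous_subtype_val) hzc
    obtain ⟨hzt, hzr⟩ := hz1
    obtain ⟨hz', hzeq⟩ := eq_Ψ P z hzO
    refine ⟨⟨z.1, hz'⟩, ?_, hzeq⟩
    show τ' ≤ (boostedKerrBackground 1 0 P.M 0).time z.1 ∧
      (boostedKerrBackground 1 0 P.M 0).radius z.1 ≤ ϱ ((boostedKerrBackground 1 0 P.M 0).time z.1)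
    rw [bg_time, bg_radius]
    exact ⟨hzt, hzr⟩

/-! ### The antecedent bundles of the crux on the model -/

/-- **`HonestCore` holds in the model** (the let-bound `Hc` of `Theses/StarvedNecks.lean`, verbatim), in
every class `Cᵏ`: (a) `|0| < M`, `100M ≤ R₀`, `(1 e₀)⁰ = 1 > 0`; (b) anchoring by the static flow `∂₀`;
(c) closures of closed late tube portions add only horizon points, not in `O`; (d) `dΦ(e₀) = e₀` is
future timelike on `{r > 2M}`.  (Proof = `SchwModel.honestCore_decomp` with `τ₀ = 1`.)
Dafermos–Rodnianski arXiv:0811.0354, §5.1. [folklore] -/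
theorem honestCore_decompK :
    let Hc := ( fun (𝓢 : Spacetime.{0} 4) (O : Set 𝓢.carrier) (k : ℕ) (d : FinalStateDecomposition 𝓢 O k) (R₀ : ℝ) => let B := d.background; let t := fun i ↦ (B i).time; let r := fun i ↦ (B i).radius; let Ψ := d.chart; (∀ i, Kerr.IsSubextremal (d.mass i) (d.spin i) ∧ 100 * d.mass i ≤ R₀ ∧ 0 < ((d.motion i).1 : E4 ≃L[ℝ] E4) (E4.basisVector 0) 0) ∧ (∀ i (ϱ τ₂ : ℝ), R₀ ≤ ϱ → d.τ₀ < τ₂ → Ψ i '' {x | d.τ₀ < t i x.1 ∧ t i x.1 < τ₂ ∧ r i x.1 < ϱ} ⊆ 𝓢.metric.causalPast 𝓢.timeOrientation (Ψ i '' (B i).truncTimeSlab ϱ τ₂)) ∧ (∀ i (τ' : ℝ) (ϱ : ℝ → ℝ), Continuous ϱ → d.τ₀ < τ' → let A := Ψ i '' {x | τ' ≤ t i x.1 ∧ r i x.1 ≤ ϱ (t i x.1)}; closure A ∩ O ⊆ A) ∧ (∀ y : d.flatDomain, d.τ₀ < y.1 0 → 𝓢.timeOrientation.IsFutureDirected (mfderiv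 𝓘(ℝ, E4) (𝓡 4) d.flatChart y (E4.basisVector 0))) )
    Hc (ST P) (O P) k (decompK P k) P.R₀ := by
  intro Hc
  refine ⟨fun i ↦ ⟨?_, P.hR₀, ?_⟩, ?_, ?_, ?_⟩
  · -- (a) sub-extremal
    show |(0 : ℝ)| < P.M
    rw [abs_zero]; exact P.hM
  · -- (a) orthochronous
    show (0 : ℝ) < (((1 : lorentzGroup) : E4 ≃L[ℝ] E4) (E4.basisVector 0)) 0
    rw [motion_e0]
    simp
  · -- (b) anchoring by the static flow
    rintro i ϱ τ₂ - - _ ⟨x, ⟨-, hxτ, hxr⟩, rfl⟩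
    simp only [decompK_background, bg_time, bg_radius] at hxτ hxr
    set s : ℝ := τ₂ - x.1 0 with hs
    have hs0 : 0 ≤ s := by linarith
    have hqO : up P (Ψ P x) s ∈ O P := by rw [mem_O, radius_up]; exact Ψ_mem_O P x
    refine causalFuture_mono (singleton_subset_iff.mpr ?_) (mem_causalPast_up P _ (Ψ_mem_O P x) hs0)
    obtain ⟨hq', hqeq⟩ := eq_Ψ P (up P (Ψ P x) s) hqO
    refine ⟨⟨(up P (Ψ P x) s).1, hq'⟩, ⟨?_, ?_⟩, hqeq⟩
    · show poincareInv 1 0 (up P (Ψ P x) s).1 0 = τ₂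
      rw [poincareInv_one_zero, up_zero_apply, Ψ_val, hs]; ring
    · show Kerr.radius 0 (poincareInv 1 0 (up P (Ψ P x) s).1) ≤ ϱ
      rw [poincareInv_one_zero, radius_up, Ψ_val]; exact hxr.le
  · -- (c) relative closedness in `O`
    intro i τ' ϱ hϱ _ _ z hz
    obtain ⟨hzc, hzO⟩ := hz
    set C : Set E4 := {w | τ' ≤ w 0 ∧ Kerr.radius 0 w ≤ ϱ (w 0)} with hC
    have hCc : IsClosed C :=
      (isClosed_le continuous_const (PiLp.continuous_apply 2 _ 0)).inter
        (isClosed_le (Kerr.continuous_radius 0) (hϱ.comp (PiLp.continuous_apply 2 _ 0)))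
    have hsub : (decompK P k).chart i '' {x | τ' ≤ ((decompK P k).background i).time x.1 ∧
        ((decompK P k).background i).radius x.1 ≤ ϱ (((decompK P k).background i).time x.1)} ⊆
        Subtype.val ⁻¹' C := by
      rintro _ ⟨x, ⟨h1, h2⟩, rfl⟩
      simp only [decompK_background, bg_time, bg_radius] at h1 h2
      exact ⟨h1, h2⟩
    have hz1 : z.1 ∈ C := closure_minimal hsub (hCc.preimage continuous_subtype_val) hzc
    obtain ⟨hzt, hzr⟩ := hz1
    obtain ⟨hz', hzeq⟩ := eq_Ψ P z hzO
    refine ⟨⟨z.1, hz'⟩, ?_, hzeq⟩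
    show τ' ≤ (boostedKerrBackground 1 0 P.M 0).time z.1 ∧
      (boostedKerrBackground 1 0 P.M 0).radius z.1 ≤ ϱ ((boostedKerrBackground 1 0 P.M 0).time z.1)
    rw [bg_time, bg_radius]
    exact ⟨hzt, hzr⟩
  · -- (d) the flat chart is future oriented
    intro y _
    have hrad : 2 * P.M < Kerr.radius 0 (Φ P y).1 := Φ_mem_O P y
    exact (congrArg (fun w : E4 ↦ (ST P).timeOrientation.IsFutureDirected (x := Φ P y) w)
      (OpensChart.mfderiv_inclusion_apply (hUreg P) y (E4.basisVector 0))).mpr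
        (Schw.isFutureDirected_e0 (hM := P.hM.le) (Φ P y) hrad)

/-- **`HonestFar` holds in the model** (the let-bound `Hf` of `Theses/StarvedNecks.lean`, verbatim), in
every class `Cᵏ`: (1) a flat-late point `y` (`y⁰ > 1`) reaches every later flat slab along the tilted
line `y + σ(∂₀ + (3/4) ȳ/‖ȳ‖)` — future timelike on `{r ≥ 14M}` and escaping the tube wall, whose speed
is `≤ 1/2` from flat time `1` (`flat_mem_causalPast_slab`); (2) closures of the far flat slabs
`{τ' ≤ x⁰, r ≥ ρ + 1}` stay in `U`, hence are flat points; (3) the hole chart is exactly Kerr–Schild,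
so its `C⁰` deviation on the Voronoi cell (everything, `N = 1`) is `0 ≤ 1/(10‖1‖²)`.
Dafermos–Rodnianski arXiv:0811.0354, §5.1. [folklore] -/
theorem honestFar_decompK :
    let Hf := ( fun (𝓢 : Spacetime.{0} 4) (O : Set 𝓢.carrier) (k : ℕ) (d : FinalStateDecomposition 𝓢 O k) (R₀ : ℝ) => let B := d.background; let t := fun i ↦ (B i).time; let r := fun i ↦ (B i).radius; let Φ := d.flatChart; (∀ τ₂ : ℝ, d.τ₀ < τ₂ → Φ '' {y | d.τ₀ < y.1 0 ∧ y.1 0 < τ₂} ⊆ 𝓢.metric.causalPast 𝓢.timeOrientation (Φ '' (Minkowski.backgroundOn d.flatDomain).timeSlab τ₂)) ∧ (∀ τ' : ℝ, d.τ₀ < τ' → closure (Φ '' {y | τ' ≤ y.1 0 ∧ ∀ i, d.excision i (y.1 0) + 1 ≤ r i y.1}) ⊆ Φ '' {y | τ' ≤ y.1 0}) ∧ (∀ i, ∃ T : ℝ, supCkENorm (Subtype.val '' {x : (B i).domain | T ≤ t i x.1 ∧ R₀ ≤ r i x.1 ∧ ∀ j, j ≠ i → r i x.1 ≤ r j x.1})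 0 (𝓢.deviationExtend (B i) (d.chart i)) ≤ ENNReal.ofReal (1 / (10 * ‖(((d.motion i).1 : E4 ≃L[ℝ] E4) : E4 →L[ℝ] E4)‖ ^ 2))) )
    Hf (ST P) (O P) k (decompK P k) P.R₀ := by
  intro Hf
  refine ⟨?_, ?_, ?_⟩
  · -- (1) flat-late points lie below later flat slabs: tilted escape lines
    rintro τ₂ - _ ⟨y, ⟨hy1, hy2⟩, rfl⟩
    change (1 : ℝ) < y.1 0 at hy1
    obtain ⟨hmem, hle⟩ := flat_mem_causalPast_slab P y hy1.le hy2
    refine causalFuture_mono (singleton_subset_iff.mpr ?_) hle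
    refine ⟨⟨y.1 + (τ₂ - y.1 0) • escVec y.1, hmem⟩, ?_, rfl⟩
    show (y.1 + (τ₂ - y.1 0) • escVec y.1) 0 = τ₂
    rw [add_smul_escVec_apply_zero]; ring
  · -- (2) closures of far flat slabs are flat points
    intro τ' hτ' z hz
    change (1 : ℝ) < τ' at hτ'
    let i0 : Fin (decompK P k).N := ⟨0, Nat.one_pos⟩
    set C : Set E4 := {w | τ' ≤ w 0 ∧ ρ P (w 0) + 1 ≤ Kerr.radius 0 w} with hC
    have hCc : IsClosed C :=
      (isClosed_le continuous_const (PiLp.continuous_apply 2 _ 0)).inter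
        (isClosed_le (((continuous_ρ P).comp (PiLp.continuous_apply 2 _ 0)).add continuous_const)
          (Kerr.continuous_radius 0))
    have hsub : (decompK P k).flatChart '' {y | τ' ≤ y.1 0 ∧ ∀ i, (decompK P k).excision i (y.1 0) + 1 ≤
        ((decompK P k).background i).radius y.1} ⊆ Subtype.val ⁻¹' C := by
      rintro _ ⟨y, ⟨hyt, hyr⟩, rfl⟩
      have h := hyr i0
      simp only [decompK_excision, decompK_background, bg_radius] at h
      exact ⟨hyt, h⟩
    have hz1 : z.1 ∈ C := closure_minimal hsub (hCc.preimage continuous_subtype_val) hz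
    obtain ⟨hzt, hzr⟩ := hz1
    have hzU : z.1 ∈ U P := ⟨by linarith, by linarith⟩
    exact ⟨⟨z.1, hzU⟩, hzt, Subtype.ext rfl⟩
  · -- (3) Voronoi `C⁰` honesty: the hole deviation vanishes identically
    intro i
    refine ⟨0, ?_⟩
    show supCkENorm _ 0 ((ST P).deviationExtend (boostedKerrBackground 1 0 P.M 0) (Ψ P)) ≤ _
    rw [deviationExtend_Ψ, supCkENorm_zero]
    exact bot_le

/-- **Distinct velocities** hold in the model (one hole: vacuous). [folklore] -/
theorem distinctVelocities_decompK :
    ∀ i j : Fin (decompK P k).N, i ≠ j → (((decompK P k).motion i).1 : E4 ≃L[ℝ] E4) (E4.basisVector 0) ≠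
      (((decompK P k).motion j).1 : E4 ≃L[ℝ] E4) (E4.basisVector 0) :=
  fun i j hij _ ↦ hij ((subsingleton_fin_N P k).elim i j)

end SchwGap

/-! ### Packaged non-vacuity -/

/-- **NON-VACUITY OF THE CRUX SHAPE WITH A HOLE, CONCLUSION INCLUDED.**  There are a spacetime `𝓢`, a
region `O`, a `C⁴` final-state decomposition `d` of `O` with `0 < d.N`, and `R₀` such that the three
antecedent bundles `Hc`, `Hf` (verbatim the `let`-lambdas of `Theses.StarvedNecks.NeckGapDecay`) and DV
hold AND every hole carries the crux's conclusion `GapCertificate`: the exact Schwarzschild exterior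
(`SchwGap.decompK P 4` for any admissible parameters, e.g. `SchwModel.exists_params`).  So the crux is
neither vacuous by antecedent shape nor false by a clause-typing slip of (G0)–(G5); what it leaves open is
exactly the dynamical content (and the binding to maximal vacuum Cauchy developments of admissible data,
for which the tree has no model with a hole — `Cruxes/NecksCertify/Disproof.lean` §A). [folklore] -/
theorem exists_N_one_honest_gapCertified :
    let Hc := ( fun (𝓢 : Spacetime.{0} 4) (O : Set 𝓢.carrier) (k : ℕ) (d : FinalStateDecomposition 𝓢 O k) (R₀ : ℝ) => let B := d.background; let t := fun i ↦ (B i).time; let r := fun i ↦ (B i).radius; let Ψ := d.chart; (∀ i, Kerr.IsSubextremal (d.mass i) (d.spin i) ∧ 100 * d.mass i ≤ R₀ ∧ 0 < ((d.motion i).1 : E4 ≃L[ℝ] E4) (E4.basisVector 0) 0) ∧ (∀ i (ϱ τ₂ : ℝ), R₀ ≤ ϱ → d.τ₀ < τ₂ → Ψ i '' {x | d.τ₀ < t i x.1 ∧ t i x.1 < τ₂ ∧ r i x.1 < ϱ} ⊆ 𝓢.metric.causalPast 𝓢.timeOrientation (Ψ i '' (B i).truncTimeSlab ϱ τ₂))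 ∧ (∀ i (τ' : ℝ) (ϱ : ℝ → ℝ), Continuous ϱ → d.τ₀ < τ' → let A := Ψ i '' {x | τ' ≤ t i x.1 ∧ r i x.1 ≤ ϱ (t i x.1)}; closure A ∩ O ⊆ A) ∧ (∀ y : d.flatDomain, d.τ₀ < y.1 0 → 𝓢.timeOrientation.IsFutureDirected (mfderiv 𝓘(ℝ, E4) (𝓡 4) d.flatChart y (E4.basisVector 0))) )
    let Hf := ( fun (𝓢 : Spacetime.{0} 4) (O : Set 𝓢.carrier) (k : ℕ) (d : FinalStateDecomposition 𝓢 O k) (R₀ : ℝ) => let B := d.background; let t := fun i ↦ (B i).time; let r := fun i ↦ (B i).radius; let Φ := d.flatChart; (∀ τ₂ : ℝ, d.τ₀ < τ₂ → Φ '' {y | d.τ₀ < y.1 0 ∧ y.1 0 < τ₂} ⊆ 𝓢.metric.causalPast 𝓢.timeOrientation (Φ '' (Minkowski.backgroundOn d.flatDomain).timeSlab τ₂)) ∧ (∀ τ' : ℝ, d.τ₀ < τ' → closure (Φ '' {y | τ' ≤ y.1 0 ∧ ∀ i, d.excision i (y.1 0) + 1 ≤ r i y.1}) ⊆ Φ ''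 {y | τ' ≤ y.1 0}) ∧ (∀ i, ∃ T : ℝ, supCkENorm (Subtype.val '' {x : (B i).domain | T ≤ t i x.1 ∧ R₀ ≤ r i x.1 ∧ ∀ j, j ≠ i → r i x.1 ≤ r j x.1}) 0 (𝓢.deviationExtend (B i) (d.chart i)) ≤ ENNReal.ofReal (1 / (10 * ‖(((d.motion i).1 : E4 ≃L[ℝ] E4) : E4 →L[ℝ] E4)‖ ^ 2))) )
    ∃ (𝓢 : Spacetime.{0} 4) (O : Set 𝓢.carrier) (d : FinalStateDecomposition 𝓢 O 4) (R₀ : ℝ),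
      0 < d.N ∧ Hc 𝓢 O 4 d R₀ ∧ Hf 𝓢 O 4 d R₀ ∧
      (∀ i j : Fin d.N, i ≠ j → ((d.motion i).1 : E4 ≃L[ℝ] E4) (E4.basisVector 0) ≠
        ((d.motion j).1 : E4 ≃L[ℝ] E4) (E4.basisVector 0)) ∧
      ∀ i : Fin d.N, GapCertificate 𝓢 O 4 d R₀ i := by
  intro Hc Hf
  -- mass `1`, horizon-penetrating inner radius `1 < 2M`, anchoring radius `100 = 100M`
  let P : Params := ⟨1, 1, 100, one_pos, one_pos, by norm_num, by norm_num⟩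
  exact ⟨ST P, O P, SchwGap.decompK P 4, P.R₀, Nat.one_pos,
    SchwGap.honestCore_decompK P 4, SchwGap.honestFar_decompK P 4, SchwGap.distinctVelocities_decompK P 4,
    SchwGap.gapCertificate_decompK P 4⟩

end Summit.FinalStateConjecture.FinalStateConjecture.Theorems.NeckGapDecay.Negative

end
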